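import Summits.ResolutionOfSingularities.ResolutionOfSingularities.Theorems.MarkedTransferCampaignW46MohWindowProof
import Literature.AlgebraicGeometry.Resolution.LipmanValuativeQuadraticSequenceProofs
import HarnessLib

/-!
# [OURS · L1 W4.6, rung (iii)] The Moh window is sharp: outside it (`ord f ≥ 2b`) the point blow-up of the typed
# procedure keeps a singular point over the centre (cell res-hironaka, LADDER-RESOLUTION rung L, D-0089; slot W4.6,
# seat res-L1-s46-pv-5; host route MarkedTransfer, `--supports stmt-ResolutionOfSingularities-16155 --as helper`)

HONEST FRAMING. Nothing here is a statement of H. Hironaka's manuscript (2017-03-23, [Hironaka2017]) and nothing here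
asserts that any statement of it holds. These are THEOREMS complementing `Theorems/MarkedTransferCampaignW46MohWindowProof.lean`
(same seat): there, INSIDE the window (`J_ξ = (y^b + u x^d)`, `b < d < 2b`) no point of the blow-up over `ξ` is singular for
the transform; here, OUTSIDE the window (`d ≥ 2b`, `u` arbitrary) the x-chart origin over `ξ` IS singular for the transform
(`ord ≥ b`) — so for the mechanism «`#Sing(E)` drops» the boundary `d = 2b` is exact. This is the scheme-level form of kill
test K4.6's table (res-L0-k46, kit job j258573: for the cusps `y^p + xⁿ` the typed certificate holds iff `n < 2p`; for
`n > 2p` the x-chart origin carries `y^p + x^{n−p}` and stays singular). The typed candidate carriers enter only as the DATA of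
a step (`CampaignW46.Step`, row 001 `IdealExponent.sing` / `transform`). No FACT-LIST premise; no `sorry`; axioms standard.
AI review is weaker than expert review.

## What is proved (namespace `…Theorems.CampaignW46`)

* `MohWindow.exists_originPrime` — ring level: for a regular local `R` with regular system of parameters `c` (all of `𝔪`),
  the chart ring `B_j = R[𝔪/c_j]` of the blow-up of `𝔪` has an «origin» prime `𝔴₀ ⊇ 𝔪 B_j` containing every chart
  generator `e_i = c_i/c_j`, `i ≠ j` (the kernel of `B_j → B_j/(c_j) ≅ k[T] → k`, `T ↦ 0`; tree `chartQuotEquiv`).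
* `MohWindow.le_idealOrder_controlledTransform_of_origin` — for a blow-up `π` along the reduced point `s` of a surface germ
  (`𝒪_{X,s}` regular of embedding dimension `2`, rsop `(x, y) = (c₀, c₁)`), `J_s = (y^b + u x^d)` with `1 ≤ b`, `2b ≤ d`,
  and a point `x′ = q(𝔴)` of `X′` presented by the chart `q : Spec B_x → X′` at a prime `𝔴 ∋ e_y` (the x-chart origin):
  `ord_{x′} J′ ≥ b` for `J′ = (J𝒪_{X′} : 𝓘_E^b)` — indeed `J′_{x′} = (ε^b + u t^{d−b})` with `t = x` the exceptional
  parameter and `ε = y/x ∈ 𝔪_{x′}`, an element of `𝔪_{x′}^b` since `d − b ≥ b`.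
* `MohWindow.exists_le_idealOrder_controlledTransform_of_le` — hence over such an `s` SOME point `x′` of the blow-up has
  `ord_{x′} J′ ≥ b` (the chart morphism `IsBlowup.exists_chart_morphism_of_index` at the origin prime).
* `Step.exists_mem_sing_over_of_le` — campaign level: if a step of the typed Th. 16.6 procedure blows up a closed point
  `ξ` (centre `D = {ξ}`) at which `J_ξ = (y^b + u x^d)` with `b = E.b ≥ 1` and `d ≥ 2b`, then `Sing(E′)` has a point
  over `ξ`. With `MohWindowCurveStepDrop` (inside: `#Sing` drops) this pins the window boundary for the `#Sing` invariant.

## References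

* `Theorems/MarkedTransferCampaignW46MohWindow.lean`, `…MohWindowProof.lean` (this seat); L/res-L0-k46/KILL-TEST-K4.6.md §3–§4
  (kit job j258573, `B(p) = 2p`; rider «CuspStringStall»).
* The Stacks Project, Tag 0804 (charts of a blowing up), Tag 0BIQ (`B/(c_j) ≅ (R/I)[T]`) — locators carried by the tree
  files `BlowupChartRsop.lean`, `BlowupStalkCharts.lean`, `LipmanValuativeQuadraticSequenceProofs.lean`. [StacksProject]
* H. Hironaka, ms. 2017-03-23, Th. 16.6 p.84 l.4–20, Def. 2.1 p.5 l.2–3 — scope only, under adjudication, not cited as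
  fact. [Hironaka2017]
-/

noncomputable section

set_option linter.dupNamespace false -- mandated namespace of this single-conjunct summit

open CategoryTheory AlgebraicGeometry TopologicalSpace IsLocalRing

namespace Summit.ResolutionOfSingularities.ResolutionOfSingularities.Theorems

namespace CampaignW46

open Literature.AlgebraicGeometry.Resolution
open Literature.AlgebraicGeometry.Hironaka2017.S02Preliminaries
open Literature.AlgebraicGeometry.Hironaka2017.Datum
open Scheme.IdealSheafData

universe u

namespace MohWindow

/-! ## Ring level: the origin of a chart -/

section Origin

variable {R : Type u} [CommRing R] [IsRegularLocalRing R] {n : ℕ}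

/-- **The origin of the chart `D₊(c_j t)`.** For a regular local ring `R` with regular system of parameters
`c = (c₁, …, c_n)` (generating `𝔪`), the chart ring `B_j = (R[𝔪t])_{(c_j t)}` has a prime `𝔴₀` lying over `𝔪` and
containing all chart generators `e_i = (c_i t)/(c_j t)`, `i ≠ j`: the kernel of `B_j → B_j/(c_j) ≅ (R/𝔪)[T_i : i ≠ j] → R/𝔪`,
`T_i ↦ 0` (tree `chartQuotEquiv`, Stacks 0BIQ). [cite: StacksProject, Tag 0BIQ] -/
theorem exists_originPrime (hd : (maximalIdeal R).spanFinrank = n) (c : Fin n → R)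
    (hc : Ideal.span (Set.range c) = maximalIdeal R) (j : Fin n) :
    ∃ 𝔴 : PrimeSpectrum (chartRing c j),
      𝔴.asIdeal.comap (chartBase c j) = maximalIdeal R ∧ ∀ i, i ≠ j → chartGen c j i ∈ 𝔴.asIdeal := by
  classical
  haveI hImax : (Ideal.span (Set.range c)).IsMaximal := by rw [hc]; exact maximalIdeal.isMaximal R
  have hz : Ideal.span (Set.range (Fin.append c (fun k : Fin 0 => Fin.elim0 k))) = maximalIdeal R := by
    rw [← hc]
    congr 1
    ext r
    constructor
    · rintro ⟨i, rfl⟩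
      refine Fin.addCases (fun k => ⟨k, ?_⟩) (fun k => Fin.elim0 k) i
      rw [Fin.append_left]
    · rintro ⟨k, rfl⟩
      exact ⟨Fin.castAdd 0 k, by rw [Fin.append_left]⟩
  have hqr : IsQuasiRegular c :=
    isQuasiRegular_centre c (fun k : Fin 0 => Fin.elim0 k) hz (by rw [hd, Nat.add_zero])
  letI : Field (R ⧸ Ideal.span (Set.range c)) := Ideal.Quotient.field _
  -- `ρ : B_j → B_j/(c_j) ≅ (R/𝔪)[T] → R/𝔪`, `T ↦ 0`
  set ε := chartQuotEquiv c j hqr with hε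
  set ev : MvPolynomial {i : Fin n // i ≠ j} (R ⧸ Ideal.span (Set.range c)) →+*
      R ⧸ Ideal.span (Set.range c) := MvPolynomial.eval₂Hom (RingHom.id _) (fun _ => 0) with hev
  set ρ : chartRing c j →+* R ⧸ Ideal.span (Set.range c) :=
    ev.comp (ε.symm.toRingHom.comp (Ideal.Quotient.mk (Ideal.span {chartBase c j (c j)}))) with hρ
  have hρC : ∀ r, ρ (chartBase c j r) = Ideal.Quotient.mk (Ideal.span (Set.range c)) r := by
    intro r
    have h1 : ε.symm (Ideal.Quotient.mk _ (chartBase c j r)) =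
        MvPolynomial.C (Ideal.Quotient.mk (Ideal.span (Set.range c)) r) := by
      apply ε.injective
      rw [RingEquiv.apply_symm_apply, hε, chartQuotEquiv_apply, chartQuotMap_C]
    simp only [hρ, RingHom.comp_apply, RingEquiv.toRingHom_eq_coe, RingHom.coe_coe, h1, hev,
      MvPolynomial.eval₂Hom_C, RingHom.id_apply]
  have hρX : ∀ i (hi : i ≠ j), ρ (chartGen c j i) = 0 := by
    intro i hi
    have h1 : ε.symm (Ideal.Quotient.mk _ (chartGen c j i)) = MvPolynomial.X ⟨i, hi⟩ := by
      apply ε.injective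
      rw [RingEquiv.apply_symm_apply, hε, chartQuotEquiv_apply, chartQuotMap_X]
    simp only [hρ, RingHom.comp_apply, RingEquiv.toRingHom_eq_coe, RingHom.coe_coe, h1, hev,
      MvPolynomial.eval₂Hom_X']
  have hρsurj : Function.Surjective ρ := fun y => by
    obtain ⟨r, rfl⟩ := Ideal.Quotient.mk_surjective y
    exact ⟨chartBase c j r, hρC r⟩
  haveI hmax : (RingHom.ker ρ).IsMaximal := RingHom.ker_isMaximal_of_surjective ρ hρsurj
  refine ⟨⟨RingHom.ker ρ, hmax.isPrime⟩, ?_, fun i hi => ?_⟩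
  · ext r
    rw [Ideal.mem_comap, RingHom.mem_ker, hρC, Ideal.Quotient.eq_zero_iff_mem, hc]
  · exact (RingHom.mem_ker).mpr (hρX i hi)

end Origin

/-! ## Scheme level: over a germ outside the window the x-chart origin is singular for the transform -/

section Local

variable {X X' : Scheme.{u}} {π : X' ⟶ X}

/-- **Outside the window the x-chart origin stays singular.** Let `π` be a blow-up along the ideal of a closed `Y` with
`𝓘_{Y,s} = 𝔪_s`, `𝒪_{X,s}` regular of embedding dimension `2` with regular system of parameters `c = (c₀, c₁) = (x, y)`,
`J_s = (y^b + u x^d)` with `1 ≤ b` and `2b ≤ d` (`u` arbitrary). Let `x′ = q(𝔴)` be presented by the chart morphism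
`q : Spec B_x → X′` (`B_x = 𝒪_s[𝔪_s/x]`, local isomorphism at `𝔴`, compatible with `π`) at a prime `𝔴` containing
`e_y = y/x`. Then `ord_{x′} J′ ≥ b` for `J′ = (J𝒪_{X′} : 𝓘_E^b)`: in the domain `𝒪_{X′,x′}` one has
`J_s 𝒪 = (x^b · G)`, `G = ε^b + u x^{d−b}`, hence `J′_{x′} = (G) ⊆ 𝔪^b`. [cite: StacksProject, Tag 0804] -/
theorem le_idealOrder_controlledTransform_of_origin [IsLocallyNoetherian X'] {Y : Closeds X}
    {J : X.IdealSheafData} {b d : ℕ} (hb : 1 ≤ b) (hbd : 2 * b ≤ d)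
    (x' : X') (s : X) (hs : π x' = s) [IsRegularLocalRing (X.presheaf.stalk s)]
    (hdim : (maximalIdeal (X.presheaf.stalk s)).spanFinrank = 2) (c : Fin 2 → X.presheaf.stalk s)
    (hc : Ideal.span (Set.range c) = maximalIdeal _)
    (hY : stalkIdeal (vanishingIdeal Y) s = maximalIdeal _) {u : X.presheaf.stalk s}
    (hJ : stalkIdeal J s = Ideal.span {c 1 ^ b + u * c 0 ^ d})
    (q : Spec (.of (chartRing c 0)) ⟶ X') (w : Spec (.of (chartRing c 0))) (hq : q w = x')
    [IsIso (q.stalkMap w)]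
    (hsq : q ≫ π = Spec.map (CommRingCat.ofHom (chartBase c 0)) ≫ X.fromSpecStalk s)
    (hw : chartGen c 0 1 ∈ w.asIdeal) :
    (b : ℕ∞) ≤ idealOrder (controlledTransform π (vanishingIdeal Y) J b) x' := by
  classical
  subst hs
  obtain ⟨χ, hχ₀, hloc, h𝔴₀⟩ :=
    exists_stalk_ringHom_of_chart π x' (CommRingCat.ofHom (chartBase c 0)) q w hq hsq
  have hχ : ∀ a, χ (chartBase c 0 a) = (π.stalkMap x').hom a := fun a => hχ₀ a
  have h𝔴 : w.asIdeal.comap (chartBase c 0) = maximalIdeal (X.presheaf.stalk (π x')) := h𝔴₀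
  clear hχ₀ h𝔴₀
  letI := χ.toAlgebra
  haveI : IsLocalization.AtPrime (X'.presheaf.stalk x') w.asIdeal := hloc
  have halg : ∀ z, (algebraMap (chartRing c 0) (X'.presheaf.stalk x') :
      chartRing c 0 →+* X'.presheaf.stalk x') z = χ z := fun _ => rfl
  obtain ⟨hLreg, ht1, ht2⟩ :=
    chart_isRegularLocalRing_and_not_mem_sq hdim c hc 0 w.asIdeal h𝔴 (X'.presheaf.stalk x')
  haveI := hLreg
  haveI := isDomain_of_isRegularLocalRing (X'.presheaf.stalk x')
  -- `ψ = π^♯_{x′}` (introduced by hand: `set` would try to abstract it inside the chart data and time out)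
  obtain ⟨ψ, hψ⟩ : ∃ ψ : X.presheaf.stalk (π x') →+* X'.presheaf.stalk x', ψ = (π.stalkMap x').hom :=
    ⟨_, rfl⟩
  have hχψ : ∀ a, χ (chartBase c 0 a) = ψ a := fun a => by rw [hψ]; exact hχ a
  rw [halg, hχψ] at ht1 ht2
  have hrel : ∀ i, ψ (c i) = ψ (c 0) * χ (chartGen c 0 i) := by
    rw [hψ]; exact stalkMap_apply_eq_mul_chartGen 0 χ hχ
  have hε : χ (chartGen c 0 1) ∈ maximalIdeal (X'.presheaf.stalk x') := by
    rw [← halg]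
    exact (IsLocalization.AtPrime.to_map_mem_maximal_iff _ w.asIdeal _).mpr hw
  obtain ⟨m, rfl⟩ : ∃ m, d = b + m := Nat.exists_eq_add_of_le (by omega : b ≤ d)
  have hmb : b ≤ m := by omega
  -- the transform `G = ε^b + u t^m` of `g = y^b + u x^{b+m}`: `ψ g = t^b · G`, `G ∈ 𝔪^b`
  -- (`G` introduced by hand: `set` would try to abstract it inside the chart data and time out)
  obtain ⟨G, hG_def⟩ : ∃ G : X'.presheaf.stalk x', G = χ (chartGen c 0 1) ^ b + ψ u * ψ (c 0) ^ m :=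
    ⟨_, rfl⟩
  have hG : ψ (c 1 ^ b + u * c 0 ^ (b + m)) = ψ (c 0) ^ b * G := by
    have h1 : ψ (c 1) = ψ (c 0) * χ (chartGen c 0 1) := hrel 1
    have hL : ψ (c 1 ^ b + u * c 0 ^ (b + m)) = ψ (c 1) ^ b + ψ u * ψ (c 0) ^ (b + m) := by
      simp only [map_add, map_mul, map_pow]
    rewrite [hL, h1, hG_def]
    ring
  have hGm : G ∈ maximalIdeal (X'.presheaf.stalk x') ^ b := by
    rw [hG_def]
    exact add_mem (Ideal.pow_mem_pow hε b)
      (Ideal.mul_mem_left _ _ (Ideal.pow_le_pow_right hmb (Ideal.pow_mem_pow ht1 m)))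
  have ht0 : ψ (c 0) ^ b ≠ 0 := by
    refine pow_ne_zero _ fun h => ht2 ?_
    rw [h]
    exact zero_mem _
  -- `J′_{x′} = ((ψ g) : (ψ x)^b) ⊆ 𝔪^b`
  have hcY : Ideal.span (Set.range c) = stalkIdeal (vanishingIdeal Y) (π x') := hc.trans hY.symm
  have hCmap : (stalkIdeal (vanishingIdeal Y) (π x')).map ψ = Ideal.span {ψ (c 0)} := by
    rw [← hcY, Ideal.map_span_range_eq_span_singleton _ c 0 _ hrel]
  have hJmap : (stalkIdeal J (π x')).map ψ = Ideal.span {ψ (c 0) ^ b * G} := by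
    rw [hJ, Ideal.map_span, Set.image_singleton, hG]
  rw [le_idealOrder_iff, controlledTransform, stalkIdeal_colon, stalkIdeal_pow,
    stalkIdeal_comap_eq_map_stalkMap, stalkIdeal_comap_eq_map_stalkMap, ← hψ, hCmap, hJmap]
  intro z hz
  have h1 := Submodule.mem_colon.mp hz (ψ (c 0) ^ b)
    (by rw [Ideal.span_singleton_pow]; exact Ideal.mem_span_singleton_self _)
  rw [smul_eq_mul] at h1
  obtain ⟨r, hr⟩ := Ideal.mem_span_singleton'.mp h1
  have hzr : z = r * G := by
    apply mul_left_cancel₀ ht0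
    rw [mul_comm (ψ (c 0) ^ b) z, ← hr]
    ring
  rw [hzr]
  exact Ideal.mul_mem_left _ r hGm

/-- **Existence of the singular point over a germ outside the window.** With `π`, `Y`, `s`, `c = (x, y)`, `J_s = (y^b + u x^d)`,
`1 ≤ b`, `2b ≤ d` as above: some point `x′ ∈ X′` over `s` has `ord_{x′} J′ ≥ b` — the x-chart origin, i.e. the image of
the origin prime (`exists_originPrime`) under the chart morphism `Spec B_x → X′` (`IsBlowup.exists_chart_morphism_of_index`).
[cite: StacksProject, Tag 0804] -/
theorem exists_le_idealOrder_controlledTransform_of_le [IsLocallyNoetherian X'] {Y : Closeds X}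
    (hπ : IsBlowup π (vanishingIdeal Y)) {J : X.IdealSheafData} {b d : ℕ} (hb : 1 ≤ b) (hbd : 2 * b ≤ d)
    {s : X} [IsRegularLocalRing (X.presheaf.stalk s)] (hdim : (maximalIdeal (X.presheaf.stalk s)).spanFinrank = 2)
    (c : Fin 2 → X.presheaf.stalk s) (hc : Ideal.span (Set.range c) = maximalIdeal _)
    (hY : stalkIdeal (vanishingIdeal Y) s = maximalIdeal _) {u : X.presheaf.stalk s}
    (hJ : stalkIdeal J s = Ideal.span {c 1 ^ b + u * c 0 ^ d}) :
    ∃ x' : X', π x' = s ∧ (b : ℕ∞) ≤ idealOrder (controlledTransform π (vanishingIdeal Y) J b) x' := by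
  have hcY : Ideal.span (Set.range c) = stalkIdeal (vanishingIdeal Y) s := hc.trans hY.symm
  obtain ⟨q, hqiso, hsq⟩ := hπ.exists_chart_morphism_of_index s c hcY 0
  obtain ⟨w, hwm, hwe⟩ := exists_originPrime hdim c hc 0
  haveI := hqiso w
  have hpt : Spec.map (CommRingCat.ofHom (chartBase c 0)) w = closedPoint (X.presheaf.stalk s) :=
    PrimeSpectrum.ext hwm
  have hs : π (q w) = s := by
    rw [← Scheme.Hom.comp_apply, hsq, Scheme.Hom.comp_apply, hpt]
    exact Scheme.fromSpecStalk_closedPoint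
  exact ⟨q w, hs, le_idealOrder_controlledTransform_of_origin hb hbd (q w) s hs hdim c hc hY hJ q w
    rfl hsq (hwe 1 (by decide))⟩

end Local

end MohWindow

/-! ## Campaign level: outside the window a point blow-up of the typed procedure keeps a singular point over the centre -/

section Campaign

variable {n : ℕ} {p : ℕ} [Fact p.Prime] {K : Type u} [Field K] [CharP K p]
variable {N : Notions.{u} n} {A A' : AmbientDatum p K} {E : IdealExponent A.Z} {R : Resume N A E}

/-- [OURS · L1 W4.6 rung (iii), boundary; NOT a statement of the manuscript] **Outside the Moh window the typed step does
NOT clear the fibre.** Let a step `s` of the typed Th. 16.6 procedure blow up the closed point `ξ` (centre `D = {ξ}` as a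
set — forced whenever `Sing(E) = {ξ}`, `IsCentre.exists_coe_eq_singleton`), where `𝒪_{Z,ξ}` is regular of embedding
dimension `2` with regular system of parameters `(x, y) = (c₀, c₁)` and `J_ξ = (y^b + u·x^d)` with `b = E.b ≥ 1` and
`d ≥ 2b`. Then `Sing(E′)` contains a point over `ξ`. Contrast `MohWindowCurveStepDrop` (`b < d < 2b`, `u` a unit: `#Sing`
drops); together they pin the window boundary `d = 2b` for the `#Sing` mechanism (K4.6: `B(p) = 2p`). [folklore] -/
theorem Step.exists_mem_sing_over_of_le (s : Step R A') {ξ : A.Z} (hD : (s.D : Set A.Z) = {ξ})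
    (hξ : IsClosed ({ξ} : Set A.Z)) [IsRegularLocalRing (A.Z.presheaf.stalk ξ)]
    (hdim : (maximalIdeal (A.Z.presheaf.stalk ξ)).spanFinrank = 2) (c : Fin 2 → A.Z.presheaf.stalk ξ)
    (hc : Ideal.span (Set.range c) = maximalIdeal _) {u : A.Z.presheaf.stalk ξ} {d : ℕ} (hb : 1 ≤ E.b)
    (hbd : 2 * E.b ≤ d) (hJ : stalkIdeal E.J ξ = Ideal.span {c 1 ^ E.b + u * c 0 ^ d}) :
    ∃ x' ∈ s.E'.sing, s.π.base x' = ξ := by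
  haveI : IsLocallyNoetherian A'.Z := by
    haveI := A'.smooth
    exact LocallyOfFiniteType.isLocallyNoetherian A'.hom
  have hY : stalkIdeal (vanishingIdeal s.D) ξ = maximalIdeal (A.Z.presheaf.stalk ξ) := by
    apply stalkIdeal_vanishingIdeal_eq_maximalIdeal_of_closure_eq
    rw [hD, hξ.closure_eq]
  obtain ⟨x', hx', hle⟩ :=
    MohWindow.exists_le_idealOrder_controlledTransform_of_le s.blowup hb hbd hdim c hc hY hJ
  exact ⟨x', hle, hx'⟩

end Campaign

end CampaignW46

end Summit.ResolutionOfSingularities.ResolutionOfSingularities.Theorems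

end
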